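import Mathlib
import HarnessLib
import Summits.HubbardSuperconductivity.HubbardSuperconductivity.Theorems.KLProgrammeKLRegimeSplitFlowPieceOscJets
import Summits.HubbardSuperconductivity.HubbardSuperconductivity.Theorems.KLProgrammeKLRegimeFramePosKernelL1
import Summits.HubbardSuperconductivity.HubbardSuperconductivity.Theorems.KLProgrammeKLRegimeEngineFramePosKernelPieces

/-!
# Route `KLProgramme`, crux K3 — gen-8 ENGINE-FLOW child (stmt-HubbardSuperconductivity-20437 `KLRegimeEngineV17F2`), located risk #9 / (K5′) / plan g20
# (R60) GO (b) «WIENER-FROM-JETS»: the positional `ℓ¹` (Wiener) size of the MEAN-FREE flow pieces is `O(U²)·4^{−m}` under `FlowPieceOscAt`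
# (`O(U²)·2^{−m}` from the registered history alone) — from k3c2-p3's `Σ_z‖Ǩ_L(z)‖ ≤ 256·√(24π²AD + 64A²)`
# (cell gate-hubbard-kl, seat hubbard-kl-r2d-p1 g9; memo `RISK9-CONSUMER-e-r2dp1-g9.md` §2 on 20437)

WHY.  In the Leibniz bookkeeping of the grid atom's space row (`Literature.…TorusFourierSubadditiveConvolution`, p571028) every first moment `M₁` of the
frame's position kernel is multiplied by the MASS `ℓ¹ = Σ_z‖Ǩ_L(z)‖` of another factor; for the flow frame `K_n = s_n + Σ_{m<n} r_m` (constants +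
mean-free pieces, …SplitFlowPieceOscJets) the constant has `ℓ¹ = |s_n| = O(|U|)` and position kernel `s_n·δ₀`, and this file shows the mean-free pieces
have `ℓ¹ = O(U²)` with geometric decay in `m`, from the REGISTERED jets (`FlowPieceJetsAt`, order 2) and the order-0 oscillation law:

* §1 bookkeeping: `framePosKernel_fsub`, `framePosKernel_symInterp_const` (`= c·[z = 0]`: a constant frame is ultralocal), `frameShift_fsub_symInterp_const`;
* §2 **`sum_norm_framePosKernel_fsub_const_le_of_bounds`** — for ANY `TrigPolyC4v` `P` and constant `c`: `|evalM P − c| ≤ A`, `‖D² evalM P‖ ≤ D` (`A, D > 0`) ⇒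
  `Σ_z ‖(P ⊖ c)ˇ_L(z)‖ ≤ 256·√(24π²AD + 64A²)`, uniformly in `L` (k3c2-p3's `sum_norm_framePosKernel_le_of_bounds` on the frame `P ⊖ c`);
* §3 the flow-piece instances: **`sum_norm_framePosKernel_flowPieceOsc_le`** — `FlowPieceOscAt … c″ … m` ∧ `FlowPieceJetsAt … R m` ⇒
  `Σ_z ‖(klFlowPiece m ⊖ mean ν_m)ˇ_L(z)‖ ≤ 256·√(24π²c″·Gfr₂ + 64c″²)·U²·4^{−m}` (law `U²·4^{−m}`, summable: `…_sum_le`, `≤ (4/3)·256√(…)·U²`);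
  **`sum_norm_framePosKernel_flowPieceOsc_le_of_readJetsF`** — from `TwoLegReadJetsF … m` (HistP's two-leg slot) + `FlowPieceJetsAt … R m` (HistP's renorm slot) alone:
  `≤ 256·√(48π³(S₁+S₁′|U|)·Gfr₂ + 256π²(S₁+S₁′|U|)²)·U²·2^{−m}` (law `U²·2^{−m}`, still summable);
* §4 **`sum_norm_framePosKernel_klFlowFrameU_le_of_osc`** — the WHOLE flow frame: `ℓ¹(Ǩ_n) ≤ (16/15)·cr·e₀·|U| + (4/3)·256√(…)·U²` (the `|U|` is carried by
  the δμ constants only; compare the jets-only `κ_R|U|` of `sum_norm_framePosKernel_le_linear_of_frameOK`).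

Proofs only; no definitions; nothing about the Hubbard model is asserted (implications from the named clauses); nothing here asserts any stub of 20437, K3
or superconductivity.  References: BGM 2003 §1.2 (2.10); BGM 2006 §2.4 (2.36), §3 (3.3) [cite: BenfattoGiulianiMastropietro2006].
-/

noncomputable section

namespace Summit.HubbardSuperconductivity.HubbardSuperconductivity.Theorems.KLRegimeSplit

set_option linter.dupNamespace false -- summit = problem name (single-conjunct summit), D-0017

open Real Finset Complex Literature.MathematicalPhysics.QuantumLattice Literature.Probability.LatticeModels
open Literature.MathematicalPhysics.QuantumLattice.FermiRG
open Summit.HubbardSuperconductivity.HubbardSuperconductivity.Theorems.DispersionFlow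
open Summit.HubbardSuperconductivity.HubbardSuperconductivity.Theorems.TorusFourierL2
open Summit.HubbardSuperconductivity.HubbardSuperconductivity.Theorems.EngineV8
open scoped ComplexConjugate

/-! ## §1 Bookkeeping: position kernels of differences and of constant frames -/

section Book

variable {L : ℕ} [NeZero L]

/-- The position kernel is additive: `(A ⊖ B)ˇ_L = Ǎ_L − B̌_L`. -/
theorem framePosKernel_fsub (A B : TrigPolyC4v) (z : TorusSite 2 L) :
    framePosKernel L (fsub A B) z = framePosKernel L A z - framePosKernel L B z := by
  unfold framePosKernel
  rw [← mul_sub, ← Finset.sum_sub_distrib]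
  congr 1
  refine Finset.sum_congr rfl fun q _ => ?_
  rw [eval_fsub, Complex.ofReal_sub, sub_mul]

/-- **A constant frame is ultralocal**: the position kernel of `symInterp L (fun _ => c)` is `c·[z = 0]`. -/
theorem framePosKernel_symInterp_const (c : ℝ) (z : TorusSite 2 L) :
    framePosKernel L (symInterp L fun _ => c) z = if z = 0 then (c : ℂ) else 0 := by
  unfold framePosKernel
  simp_rw [eval_symInterp_const, ← Finset.mul_sum]
  have hconj : ∑ q : TorusSite 2 L, conj (torusChar q z) = ∑ q : TorusSite 2 L, torusChar q (-z) :=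
    Finset.sum_congr rfl fun q _ => (torusChar_neg_right q z).symm
  rw [hconj, sum_torusChar_left]
  have hL : (L : ℂ) ≠ 0 := by exact_mod_cast NeZero.ne L
  by_cases hz : z = 0
  · subst hz
    rw [neg_zero, if_pos rfl, if_pos rfl]
    field_simp
  · have hnz : -z ≠ 0 := fun h => hz (neg_eq_zero.1 h)
    rw [if_neg hnz, if_neg hz, mul_zero, mul_zero]

/-- Off the origin the position kernel does not see a subtracted constant: `(A ⊖ c)ˇ_L(z) = Ǎ_L(z)` for `z ≠ 0`. -/
theorem framePosKernel_fsub_const_of_ne (A : TrigPolyC4v) (c : ℝ) {z : TorusSite 2 L} (hz : z ≠ 0) :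
    framePosKernel L (fsub A (symInterp L fun _ => c)) z = framePosKernel L A z := by
  rw [framePosKernel_fsub, framePosKernel_symInterp_const, if_neg hz, sub_zero]

/-- `frameShift (A ⊖ c) = frameShift A + c` (recall `frameShift K = −evalM K`). -/
theorem frameShift_fsub_symInterp_const (A : TrigPolyC4v) (c : ℝ) :
    frameShift (fsub A (symInterp L fun _ => c)) = fun q => -(evalM A q - c) := by
  funext q
  rw [frameShift, ← evalM_apply, evalM_fsub, evalM_symInterp_const]

end Book

/-! ## §2 Wiener-from-jets for a frame minus a constant -/

section Generic

variable {L : ℕ} [NeZero L]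

/-- **WIENER SIZE OF `P ⊖ c` FROM ITS OSCILLATION AND ITS HESSIAN**: for any frame `P`, constant `c` and `A, D > 0` with `|evalM P q − c| ≤ A` and
`‖D²(evalM P) q‖ ≤ D` everywhere, `Σ_z ‖(P ⊖ c)ˇ_L(z)‖ ≤ 256·√(24π²·A·D + 64·A²)` for every `L` (k3c2-p3's `sum_norm_framePosKernel_le_of_bounds`:
the constant is free at orders `≥ 1`). -/
theorem sum_norm_framePosKernel_fsub_const_le_of_bounds (P : TrigPolyC4v) (c : ℝ) {A D : ℝ} (hA : 0 < A) (hD : 0 < D)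
    (h0 : ∀ q : Momentum, |evalM P q - c| ≤ A) (h2 : ∀ q : Momentum, ‖iteratedFDeriv ℝ 2 (evalM P) q‖ ≤ D) :
    ∑ z : TorusSite 2 L, ‖framePosKernel L (fsub P (symInterp L fun _ => c)) z‖ ≤ 256 * Real.sqrt (24 * π ^ 2 * A * D + 64 * A ^ 2) := by
  refine sum_norm_framePosKernel_le_of_bounds _ hA hD (fun q => ?_) (fun q => ?_)
  · rw [frameShift_fsub_symInterp_const, abs_neg]
    exact h0 q
  · have hneg : frameShift (fsub P (symInterp L fun _ => c)) = -(fun q => evalM P q - c) := by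
      rw [frameShift_fsub_symInterp_const]; rfl
    rw [hneg, iteratedFDeriv_neg_apply, norm_neg, iteratedFDeriv_evalM_sub_const P c two_ne_zero q]
    exact h2 q

/-- The law behind the instances: for `0 ≤ X`, `0 ≤ Y`, `0 ≤ θ ≤ 1`, `√(X·θ + Y·θ²) ≤ √(X + Y)·√θ`. -/
theorem sqrt_mul_add_mul_sq_le {X Y θ : ℝ} (hX : 0 ≤ X) (hY : 0 ≤ Y) (hθ : 0 ≤ θ) (hθ1 : θ ≤ 1) :
    Real.sqrt (X * θ + Y * θ ^ 2) ≤ Real.sqrt (X + Y) * Real.sqrt θ := by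
  rw [← Real.sqrt_mul (by positivity)]
  refine Real.sqrt_le_sqrt ?_
  have hθ2 : θ ^ 2 ≤ θ := by nlinarith
  have h := mul_le_mul_of_nonneg_left hθ2 hY
  have hring : (X + Y) * θ = X * θ + Y * θ := by ring
  rw [hring]
  linarith

end Generic

/-! ## §3 The flow-piece instances -/

section Model

variable {L M : ℕ} [NeZero L] [NeZero M]

/-- `(4:ℝ)^(−2m) = ((4^m)⁻¹)²`. -/
private theorem four_zpow_neg_two_mul_eq_sq (m : ℕ) : (4 : ℝ) ^ (-2 * (m : ℤ)) = (((4 : ℝ) ^ m)⁻¹) ^ 2 := by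
  rw [four_zpow_neg_two_mul, show (16 : ℝ) = 4 ^ 2 by norm_num, ← pow_mul, inv_pow, ← pow_mul, mul_comm]

/-- **WIENER SIZE OF THE MEAN-FREE FLOW PIECE UNDER (K5′)**: `FlowPieceOscAt … c″ … m` (`0 < c″`), `FlowPieceJetsAt … R m` (`0 < R.Gfr 2`), `U ≠ 0` ⇒
`Σ_z ‖(klFlowPiece m ⊖ klAngularMean ν_m)ˇ_L(z)‖ ≤ 256·√(24π²·c″·R.Gfr 2 + 64·c″²)·U²·4^{−m}` for every torus size `L` used as position lattice. -/
theorem sum_norm_framePosKernel_flowPieceOsc_le {Lp : ℕ} [NeZero Lp] {c'' β U μ : ℝ} {m : ℕ} {R : RenConsts}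
    (hosc : FlowPieceOscAt L M c'' β U μ m) (hJ : FlowPieceJetsAt L M β U μ R m) (hc : 0 < c'') (hG : 0 < R.Gfr 2) (hU : U ≠ 0) :
    ∑ z : TorusSite 2 Lp, ‖framePosKernel Lp (fsub (klFlowPiece L M β U μ m)
        (symInterp Lp fun _ => klAngularMean (klLocalPart L M β U μ (klFlowFrameU L M β U μ m) m))) z‖ ≤
      256 * Real.sqrt (24 * π ^ 2 * c'' * R.Gfr 2 + 64 * c'' ^ 2) * (U ^ 2 * ((4 : ℝ) ^ m)⁻¹) := by
  have hU2 : 0 < U ^ 2 := by positivity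
  set t : ℝ := ((4 : ℝ) ^ m)⁻¹ with ht
  have ht0 : 0 < t := by positivity
  have ht1 : t ≤ 1 := by rw [ht]; exact inv_le_one_of_one_le₀ (one_le_pow₀ (by norm_num))
  -- A := c″·U²·t², D := Gfr₂·U²
  have hA : 0 < c'' * U ^ 2 * t ^ 2 := by positivity
  have hD : 0 < R.Gfr 2 * U ^ 2 := by positivity
  have h0 : ∀ q : Momentum, |evalM (klFlowPiece L M β U μ m) q -
      klAngularMean (klLocalPart L M β U μ (klFlowFrameU L M β U μ m) m)| ≤ c'' * U ^ 2 * t ^ 2 := fun q => by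
    have h := hosc q; rwa [four_zpow_neg_two_mul_eq_sq] at h
  have h2 : ∀ q : Momentum, ‖iteratedFDeriv ℝ 2 (evalM (klFlowPiece L M β U μ m)) q‖ ≤ R.Gfr 2 * U ^ 2 := fun q => by
    have h := hJ 2 (by norm_num) q
    rw [uPow_of_ne_zero two_ne_zero] at h
    simpa using h
  refine (sum_norm_framePosKernel_fsub_const_le_of_bounds _ _ hA hD h0 h2).trans ?_
  -- the law: pull `(U²·t)²` out of the root, bound the residual `t²` by `1`
  have hXY : 24 * π ^ 2 * (c'' * U ^ 2 * t ^ 2) * (R.Gfr 2 * U ^ 2) + 64 * (c'' * U ^ 2 * t ^ 2) ^ 2 =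
      (24 * π ^ 2 * c'' * R.Gfr 2 * (U ^ 2) ^ 2) * t ^ 2 + (64 * c'' ^ 2 * (U ^ 2) ^ 2) * (t ^ 2) ^ 2 := by ring
  rw [hXY]
  have ht2 : t ^ 2 ≤ 1 := pow_le_one₀ ht0.le ht1
  have hs := sqrt_mul_add_mul_sq_le (X := 24 * π ^ 2 * c'' * R.Gfr 2 * (U ^ 2) ^ 2) (Y := 64 * c'' ^ 2 * (U ^ 2) ^ 2)
    (θ := t ^ 2) (by positivity) (by positivity) (by positivity) ht2
  refine (mul_le_mul_of_nonneg_left hs (by norm_num)).trans (le_of_eq ?_)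
  have hfac : 24 * π ^ 2 * c'' * R.Gfr 2 * (U ^ 2) ^ 2 + 64 * c'' ^ 2 * (U ^ 2) ^ 2 =
      (24 * π ^ 2 * c'' * R.Gfr 2 + 64 * c'' ^ 2) * (U ^ 2) ^ 2 := by ring
  rw [hfac, Real.sqrt_mul (by positivity), Real.sqrt_sq hU2.le, Real.sqrt_sq ht0.le]
  ring

/-- **Summed over the pieces**: `Σ_{m<n} Σ_z ‖(r_m)ˇ_L(z)‖ ≤ (4/3)·256·√(24π²c″Gfr₂ + 64c″²)·U²` — the mean-free flow frame's Wiener size is `O(U²)`,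
uniformly in the depth. -/
theorem sum_norm_framePosKernel_flowPieceOsc_sum_le {Lp : ℕ} [NeZero Lp] {c'' β U μ : ℝ} {n : ℕ} {R : RenConsts}
    (hosc : ∀ m < n, FlowPieceOscAt L M c'' β U μ m) (hJ : ∀ m < n, FlowPieceJetsAt L M β U μ R m) (hc : 0 < c'') (hG : 0 < R.Gfr 2)
    (hU : U ≠ 0) :
    ∑ m ∈ range n, ∑ z : TorusSite 2 Lp, ‖framePosKernel Lp (fsub (klFlowPiece L M β U μ m)
        (symInterp Lp fun _ => klAngularMean (klLocalPart L M β U μ (klFlowFrameU L M β U μ m) m))) z‖ ≤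
      4 / 3 * (256 * Real.sqrt (24 * π ^ 2 * c'' * R.Gfr 2 + 64 * c'' ^ 2) * U ^ 2) := by
  calc _ ≤ ∑ m ∈ range n, 256 * Real.sqrt (24 * π ^ 2 * c'' * R.Gfr 2 + 64 * c'' ^ 2) * (U ^ 2 * ((4 : ℝ) ^ m)⁻¹) :=
        Finset.sum_le_sum fun m hm => sum_norm_framePosKernel_flowPieceOsc_le (hosc m (mem_range.1 hm)) (hJ m (mem_range.1 hm)) hc hG hU
    _ = 256 * Real.sqrt (24 * π ^ 2 * c'' * R.Gfr 2 + 64 * c'' ^ 2) * U ^ 2 * ∑ m ∈ range n, ((4 : ℝ)⁻¹) ^ m := by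
        rw [Finset.mul_sum]; refine Finset.sum_congr rfl fun m _ => ?_; rw [inv_pow]; ring
    _ ≤ 256 * Real.sqrt (24 * π ^ 2 * c'' * R.Gfr 2 + 64 * c'' ^ 2) * U ^ 2 * (4 / 3) := by
        have hgeo : ∑ m ∈ range n, ((4 : ℝ)⁻¹) ^ m ≤ 4 / 3 := by
          have h := geom_sum_Ico_le_of_lt_one (m := 0) (n := n) (x := (4 : ℝ)⁻¹) (by norm_num) (by norm_num)
          rw [← Finset.range_eq_Ico] at h
          exact h.trans (by norm_num)
        exact mul_le_mul_of_nonneg_left hgeo (by positivity)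
    _ = _ := by ring

/-- **WIENER SIZE OF THE MEAN-FREE FLOW PIECE FROM THE REGISTERED HISTORY ALONE** (no (K5′) datum): `TwoLegReadJetsF … m` (oscillation law `2π·(S₁+S₁′|U|)·U²·4^{−m}`,
…SplitFlowPieceMeanOsc), `FlowPieceJetsAt … R m`, `μ ∈ klWindowC`, `0 < S₁ + S₁′|U|`, `0 < Gfr₂`, `U ≠ 0` ⇒
`Σ_z ‖(klFlowPiece m ⊖ mean ν_m)ˇ_L(z)‖ ≤ 256·√(48π³(S₁+S₁′|U|)·Gfr₂ + 256π²(S₁+S₁′|U|)²)·U²·2^{−m}` — law `U²·2^{−m}`, summable. -/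
theorem sum_norm_framePosKernel_flowPieceOsc_le_of_readJetsF {Lp : ℕ} [NeZero Lp] {β U μ : ℝ} (hμ : μ ∈ klWindowC) {m : ℕ}
    {G : GeoConsts} {Q : EngConsts} {R : RenConsts} (hread : TwoLegReadJetsF L M G Q β U μ m) (hJ : FlowPieceJetsAt L M β U μ R m)
    (hs : 0 < G.S 1 + Q.S' 1 * |U|) (hG : 0 < R.Gfr 2) (hU : U ≠ 0) :
    ∑ z : TorusSite 2 Lp, ‖framePosKernel Lp (fsub (klFlowPiece L M β U μ m)
        (symInterp Lp fun _ => klAngularMean (klLocalPart L M β U μ (klFlowFrameU L M β U μ m) m))) z‖ ≤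
      256 * Real.sqrt (48 * π ^ 3 * (G.S 1 + Q.S' 1 * |U|) * R.Gfr 2 + 256 * π ^ 2 * (G.S 1 + Q.S' 1 * |U|) ^ 2) *
        (U ^ 2 * ((2 : ℝ) ^ m)⁻¹) := by
  have hU2 : 0 < U ^ 2 := by positivity
  set s : ℝ := G.S 1 + Q.S' 1 * |U| with hsdef
  set t : ℝ := ((4 : ℝ) ^ m)⁻¹ with ht
  have ht0 : 0 < t := by positivity
  have ht1 : t ≤ 1 := by rw [ht]; exact inv_le_one_of_one_le₀ (one_le_pow₀ (by norm_num))
  have hA : 0 < 2 * π * (s * U ^ 2 * t) := by positivity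
  have hD : 0 < R.Gfr 2 * U ^ 2 := by positivity
  have h0 : ∀ q : Momentum, |evalM (klFlowPiece L M β U μ m) q -
      klAngularMean (klLocalPart L M β U μ (klFlowFrameU L M β U μ m) m)| ≤ 2 * π * (s * U ^ 2 * t) := fun q =>
    abs_evalM_klFlowPiece_sub_mean_le_of_readJetsF hμ hread q
  have h2 : ∀ q : Momentum, ‖iteratedFDeriv ℝ 2 (evalM (klFlowPiece L M β U μ m)) q‖ ≤ R.Gfr 2 * U ^ 2 := fun q => by
    have h := hJ 2 (by norm_num) q
    rw [uPow_of_ne_zero two_ne_zero] at h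
    simpa using h
  refine (sum_norm_framePosKernel_fsub_const_le_of_bounds _ _ hA hD h0 h2).trans ?_
  -- the law: `t = ((2^m)⁻¹)²`; pull `(U²)²·t` out of the root and bound the residual `t²` by `t·1`
  have ht2 : t = (((2 : ℝ) ^ m)⁻¹) ^ 2 := by
    rw [ht, show (4 : ℝ) = 2 ^ 2 by norm_num, ← pow_mul, inv_pow, ← pow_mul, mul_comm]
  have hXY : 24 * π ^ 2 * (2 * π * (s * U ^ 2 * t)) * (R.Gfr 2 * U ^ 2) + 64 * (2 * π * (s * U ^ 2 * t)) ^ 2 =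
      (48 * π ^ 3 * s * R.Gfr 2 * (U ^ 2) ^ 2) * t + (256 * π ^ 2 * s ^ 2 * (U ^ 2) ^ 2) * t ^ 2 := by ring
  rw [hXY]
  have hs0 : 0 ≤ s := hs.le
  have hsq := sqrt_mul_add_mul_sq_le (X := 48 * π ^ 3 * s * R.Gfr 2 * (U ^ 2) ^ 2) (Y := 256 * π ^ 2 * s ^ 2 * (U ^ 2) ^ 2)
    (θ := t) (by positivity) (by positivity) ht0.le ht1
  refine (mul_le_mul_of_nonneg_left hsq (by norm_num)).trans (le_of_eq ?_)
  have hfac : 48 * π ^ 3 * s * R.Gfr 2 * (U ^ 2) ^ 2 + 256 * π ^ 2 * s ^ 2 * (U ^ 2) ^ 2 =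
      (48 * π ^ 3 * s * R.Gfr 2 + 256 * π ^ 2 * s ^ 2) * (U ^ 2) ^ 2 := by ring
  rw [hfac, Real.sqrt_mul (by positivity), Real.sqrt_sq hU2.le, ht2, Real.sqrt_sq (by positivity)]
  ring


/-! ## §4 The whole flow frame: `ℓ¹(Ǩ_n) ≤ (16/15)·cr·e₀·|U| + (4/3)·256·√(24π²c″Gfr₂ + 64c″²)·U²` (constants carry the `|U|`, mean-free pieces the `U²`) -/

/-- The position kernel of `0 ⊖ A` is minus that of `A`. -/
theorem framePosKernel_fsub_zero {Lp : ℕ} [NeZero Lp] (A : TrigPolyC4v) (z : TorusSite 2 Lp) :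
    framePosKernel Lp (fsub 0 A) z = -framePosKernel Lp A z := by
  have h0 : framePosKernel Lp (0 : TrigPolyC4v) z = 0 := by
    unfold framePosKernel; simp [TrigPolyC4v.eval_zero]
  rw [framePosKernel_fsub, h0, zero_sub]

/-- **A frame piece's Wiener size is at most that of its mean-free part plus its mean**: `Σ_z‖(A)ˇ(z)‖ ≤ Σ_z‖(A ⊖ c)ˇ(z)‖ + |c|` (the constant is
ultralocal). -/
theorem sum_norm_framePosKernel_le_osc_add_const {Lp : ℕ} [NeZero Lp] (A : TrigPolyC4v) (c : ℝ) :
    ∑ z : TorusSite 2 Lp, ‖framePosKernel Lp A z‖ ≤ (∑ z : TorusSite 2 Lp, ‖framePosKernel Lp (fsub A (symInterp Lp fun _ => c)) z‖) + |c| := by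
  classical
  have hsplit : ∀ z : TorusSite 2 Lp, framePosKernel Lp A z =
      framePosKernel Lp (fsub A (symInterp Lp fun _ => c)) z + (if z = 0 then (c : ℂ) else 0) := fun z => by
    rw [framePosKernel_fsub, framePosKernel_symInterp_const]; ring
  calc ∑ z : TorusSite 2 Lp, ‖framePosKernel Lp A z‖
      ≤ ∑ z : TorusSite 2 Lp, (‖framePosKernel Lp (fsub A (symInterp Lp fun _ => c)) z‖ + ‖(if z = 0 then (c : ℂ) else 0)‖) :=
        Finset.sum_le_sum fun z _ => by rw [hsplit z]; exact norm_add_le _ _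
    _ = (∑ z : TorusSite 2 Lp, ‖framePosKernel Lp (fsub A (symInterp Lp fun _ => c)) z‖) +
          ∑ z : TorusSite 2 Lp, ‖(if z = 0 then (c : ℂ) else 0)‖ := Finset.sum_add_distrib
    _ = (∑ z : TorusSite 2 Lp, ‖framePosKernel Lp (fsub A (symInterp Lp fun _ => c)) z‖) + |c| := by
        congr 1
        rw [Finset.sum_eq_single (0 : TorusSite 2 Lp) (fun z _ hz => by rw [if_neg hz, norm_zero]) (fun h => absurd (Finset.mem_univ _) h)]
        rw [if_pos rfl, Complex.norm_real, Real.norm_eq_abs]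

/-- **THE FLOW FRAME'S WIENER SIZE, SPLIT**: under the registered history (`RenormalisedAtF`, `FlowPieceJetsAt` at every `m < n`) and (K5′) `FlowPieceOscAt … c″ … m` at every
`m < n` (`0 < c″`, `0 < Gfr₂`, `0 ≤ cr`, `U ≠ 0`): `Σ_z ‖(K_n)ˇ_L(z)‖ ≤ (16/15)·R.cr·e₀·|U| + (4/3)·256·√(24π²c″·Gfr₂ + 64c″²)·U²` — the `|U|` is carried by the
δμ constants ONLY (coefficient `(16/15)·cr/32`), the mean-free pieces are `O(U²)`; uniformly in the depth `n` and the position lattice `L`. -/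
theorem sum_norm_framePosKernel_klFlowFrameU_le_of_osc {Lp : ℕ} [NeZero Lp] {G : GeoConsts} {P : SplitConsts} {Q : EngConsts} {R : RenConsts}
    {c'' β U μ : ℝ} {K : TrigPolyC4v} {n : ℕ} (hh : HistP klPredsV17F2 L M G P Q R β U μ K n) (hosc : ∀ m < n, FlowPieceOscAt L M c'' β U μ m)
    (hc : 0 < c'') (hG : 0 < R.Gfr 2) (hR : 0 ≤ R.cr) (hU : U ≠ 0) :
    ∑ z : TorusSite 2 Lp, ‖framePosKernel Lp (klFlowFrameU L M β U μ n) z‖ ≤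
      16 / 15 * (R.cr * klE0 * |U|) + 4 / 3 * (256 * Real.sqrt (24 * π ^ 2 * c'' * R.Gfr 2 + 64 * c'' ^ 2) * U ^ 2) := by
  -- `K_n = Σ_{m<n} (0 ⊖ piece_m)` pointwise
  have heval : ∀ p : Fin 2 → ℝ, (klFlowFrameU L M β U μ n).eval p = ∑ m ∈ range n, (fsub 0 (klFlowPiece L M β U μ m)).eval p := fun p => by
    rw [eval_klFlowFrameU]; simp only [eval_fsub, TrigPolyC4v.eval_zero, zero_sub, Finset.sum_neg_distrib]
  refine (sum_norm_framePosKernel_le_of_eval _ (range n) _ heval).trans ?_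
  -- per piece: `ℓ¹ ≤ ℓ¹(mean-free) + |mean|`
  have hJ : ∀ m < n, FlowPieceJetsAt L M β U μ R m := fun m hm => ((histP_klPredsV17F2_iff L M G P Q R β U μ K n).1 hh m hm).2.1.2.1
  have hpiece : ∀ m ∈ range n, ∑ z : TorusSite 2 Lp, ‖framePosKernel Lp (fsub 0 (klFlowPiece L M β U μ m)) z‖ ≤
      256 * Real.sqrt (24 * π ^ 2 * c'' * R.Gfr 2 + 64 * c'' ^ 2) * (U ^ 2 * ((4 : ℝ) ^ m)⁻¹) + R.cr * |U| * (klE0 * ((16 : ℝ) ^ m)⁻¹) := by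
    intro m hm
    have hm' := Finset.mem_range.1 hm
    simp_rw [framePosKernel_fsub_zero, norm_neg]
    refine (sum_norm_framePosKernel_le_osc_add_const _ (klAngularMean (klLocalPart L M β U μ (klFlowFrameU L M β U μ m) m))).trans ?_
    exact add_le_add (sum_norm_framePosKernel_flowPieceOsc_le (hosc m hm') (hJ m hm') hc hG hU)
      (abs_klAngularMean_localPart_le_of_histP hh hm')
  refine (Finset.sum_le_sum hpiece).trans ?_
  rw [Finset.sum_add_distrib]
  -- the two geometric sums
  have hgeo4 : ∑ m ∈ range n, ((4 : ℝ)⁻¹) ^ m ≤ 4 / 3 := by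
    have h := geom_sum_Ico_le_of_lt_one (m := 0) (n := n) (x := (4 : ℝ)⁻¹) (by norm_num) (by norm_num)
    rw [← Finset.range_eq_Ico] at h; exact h.trans (by norm_num)
  have hgeo16 : ∑ m ∈ range n, ((16 : ℝ)⁻¹) ^ m ≤ 16 / 15 := by
    have h := geom_sum_Ico_le_of_lt_one (m := 0) (n := n) (x := (16 : ℝ)⁻¹) (by norm_num) (by norm_num)
    rw [← Finset.range_eq_Ico] at h; exact h.trans (by norm_num)
  have hS : 0 ≤ 256 * Real.sqrt (24 * π ^ 2 * c'' * R.Gfr 2 + 64 * c'' ^ 2) * U ^ 2 := by positivity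
  have hT : 0 ≤ R.cr * |U| * klE0 := by unfold klE0; positivity
  have h1 : ∑ m ∈ range n, 256 * Real.sqrt (24 * π ^ 2 * c'' * R.Gfr 2 + 64 * c'' ^ 2) * (U ^ 2 * ((4 : ℝ) ^ m)⁻¹) ≤
      4 / 3 * (256 * Real.sqrt (24 * π ^ 2 * c'' * R.Gfr 2 + 64 * c'' ^ 2) * U ^ 2) := by
    have heq : ∑ m ∈ range n, 256 * Real.sqrt (24 * π ^ 2 * c'' * R.Gfr 2 + 64 * c'' ^ 2) * (U ^ 2 * ((4 : ℝ) ^ m)⁻¹) =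
        256 * Real.sqrt (24 * π ^ 2 * c'' * R.Gfr 2 + 64 * c'' ^ 2) * U ^ 2 * ∑ m ∈ range n, ((4 : ℝ)⁻¹) ^ m := by
      rw [Finset.mul_sum]; refine Finset.sum_congr rfl fun m _ => ?_; rw [inv_pow]; ring
    rw [heq]; nlinarith [mul_le_mul_of_nonneg_left hgeo4 hS]
  have h2 : ∑ m ∈ range n, R.cr * |U| * (klE0 * ((16 : ℝ) ^ m)⁻¹) ≤ 16 / 15 * (R.cr * klE0 * |U|) := by
    have heq : ∑ m ∈ range n, R.cr * |U| * (klE0 * ((16 : ℝ) ^ m)⁻¹) = R.cr * |U| * klE0 * ∑ m ∈ range n, ((16 : ℝ)⁻¹) ^ m := by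
      rw [Finset.mul_sum]; refine Finset.sum_congr rfl fun m _ => ?_; rw [inv_pow]; ring
    rw [heq]; nlinarith [mul_le_mul_of_nonneg_left hgeo16 hT]
  linarith

end Model

end Summit.HubbardSuperconductivity.HubbardSuperconductivity.Theorems.KLRegimeSplit

end
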